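import Summits.QuantumFields.YangMills.Theorems.ParabolicTrajectoryLatticeGapOnTrajectoryTrisectionGap
import HarnessLib

/-!
# Route `ParabolicTrajectory`, crux `LatticeGapOnTrajectory` (stmt-QuantumFields-10523): the MINIMAL conjunct (B) the gap-currency route needs — the summit's own lattice clause along tuned sequences

Sequel of `…TrisectionGap` (seat c9 of the (B) chain). Once child U of the (A) chain's regime trisection carries the
continuum gap of its own witness (`TrisectionGap.UltravioletLimitWithGapOnTrajectory`), the deciding theorem
`TrisectionGap.yangMills_of_trisectionGap` reads from conjunct (B) nothing but `Δ > 0` and `HasLatticeMassGap r sch Δ` —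
the slab-clustering conjunct of Sub₁ `Split.LatticeGapOnTrajectoryLat`, the transfer clause of the filed (B) and of its
restatement `Split.LatticeGapOnTrajectoryRV`, and every volume clause are idle on that path. This file types that minimum:

* §1 `LatticeGapOnTrajectoryMin` — along every tuned `M`-adic weak-coupling Wilson scheme, `∃ Δ > 0, HasLatticeMassGap r sch Δ`
  (the lattice clause of the sub-problem statement `YangMills` itself, asked along the route's tuned sequences; route-posited,
  NOT asserted — it is the weak-coupling lattice mass gap, open-problem strength);
* §2 it is implied by Sub₁ (`latticeGapOnTrajectoryMin_of_lat`), by the filed (B) (`latticeGapOnTrajectoryMin_of_filed`), and,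
  under the volume clause output by (S_PVG), by the restatement RV (used inside `yangMills_of_trisectionGapMin`'s sibling in
  `…TrisectionGap`); so every (B) line that closes Sub₁ modulo its physics stub closes it modulo the same stub;
* §3 `yangMills_of_trisectionGapMin : UltravioletLimitWithGapOnTrajectory → ClusteringOnTrajectory → LatticeGapOnTrajectoryMin →
  TunedSequenceExistsPVG → YangMills` and `yangMills_of_trisectionGapMin_inputs : ChartExists → UVPhysics345 →
  ClusteringOnTrajectory → LatticeGapOnTrajectoryMin → TunedSequenceExistsPVG → YangMills` — the route closes from the chart,
  the UV engine, the infrared child I, the MINIMAL (B) and the repaired (S).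
So the planner may restate (B) either as Sub₁ (landed name, what the (B) lines literally conclude) or as this minimum; both
are pure lattice statements and neither carries the residuals (α)/(β) that killed thirteen line seats on the filed text.
Refs: `…TrisectionGap`, `…LatticeGapOnTrajectorySplitDefs` §1, `Summits/QuantumFields/YangMills/Statement.lean` (`YangMills`).
-/

set_option autoImplicit false

open MeasureTheory Filter Topology
open Literature.MathematicalPhysics.QuantumFieldTheory Literature.MathematicalPhysics.QuantumLattice
open Summit.QuantumFields.YangMills.Theses.ParabolicTrajectory
open Summit.QuantumFields.YangMills.Cruxes.ContinuumLimitOnTrajectory.TwoOrbitSynchronisation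
open Summit.QuantumFields.YangMills.Cruxes.ContinuumLimitOnTrajectory.RegimeTrisection
open Summit.QuantumFields.YangMills.Cruxes.LatticeGapOnTrajectory.OrbitKantorovichFiniteSize

noncomputable section

namespace Summit.QuantumFields.YangMills.Cruxes.LatticeGapOnTrajectory.TrisectionGap

/-! ## §1 The minimal (B) (route-posited; NOT asserted) -/

/-- **The minimal conjunct (B) — `LatticeGapOnTrajectoryMin`.** For every compact simple `G`, lattice representation `r`,
`M ≥ 2`, `θ > 0` and every `M`-adic Wilson scheme with `β_k → ∞` tuned by `a_k⁻⁸⟨P; τ_{1/a_k}P⟩ → θ`, there is `Δ > 0` with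
the sub-problem's per-pair, volume-uniform lattice gap `HasLatticeMassGap r sch Δ`. Sub₁ `Split.LatticeGapOnTrajectoryLat`
minus its slab-clustering conjunct; the filed (B) minus its transfer clause. The weak-coupling lattice mass gap of
four-dimensional Yang–Mills along a tuned trajectory (open-problem strength). Route-posited statement; NOT asserted. -/
def LatticeGapOnTrajectoryMin : Prop :=
  ∀ (G : Type) [Group G] [TopologicalSpace G] [IsTopologicalGroup G] [CompactSpace G]
    [MeasurableSpace G] [BorelSpace G], IsCompactSimpleLieGroup G →
    ∀ (r : LatticeRep G) (M : ℕ) (θ : ℝ) (sch : SpeciesScheme (YMSpecies G)) (n : ℕ → ℕ),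
      2 ≤ M → 0 < θ → (∀ k, sch.a k = ((M : ℝ) ^ n k)⁻¹) → Tendsto sch.β atTop atTop →
      Tendsto (fun k => ((M : ℝ) ^ n k) ^ 8 *
          latticeConnectedCorr r.ρ (sch.β k) (sch.side k) r.curvature.F r.curvature.F (M ^ n k))
        atTop (𝓝 θ) →
      ∃ Δ : ℝ, 0 < Δ ∧ HasLatticeMassGap r sch Δ

/-! ## §2 Read-backs: Sub₁ and the filed (B) imply the minimum -/

/-- Sub₁ `Split.LatticeGapOnTrajectoryLat` implies the minimal (B) (drop the slab-clustering conjunct). Hence every (B)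
line closing Sub₁ modulo its physics stub (`Split.latticeGapOnTrajectoryLat_of_windowsP`, `…DecayInterface`,
`…StepScaling`) closes the minimum modulo the same stub. -/
theorem latticeGapOnTrajectoryMin_of_lat : Split.LatticeGapOnTrajectoryLat → LatticeGapOnTrajectoryMin := by
  intro h G _ _ _ _ _ _ hG r M θ sch n hM hθ hshape hβ htune
  obtain ⟨Δ, hΔ, hgap, -⟩ := h G hG r M θ sch n hM hθ hshape hβ htune
  exact ⟨Δ, hΔ, hgap⟩

/-- The filed (B) `LatticeGapOnTrajectory` implies the minimal (B) (drop the transfer clause): the minimum is a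
weakening of the crux as filed, so nothing the route proves FROM the minimum is lost. -/
theorem latticeGapOnTrajectoryMin_of_filed : LatticeGapOnTrajectory → LatticeGapOnTrajectoryMin := by
  intro h G _ _ _ _ _ _ hG r M θ sch n hM hθ hshape hβ htune
  have hB : ‹MeasurableSpace G› = borel G := BorelSpace.measurable_eq
  subst hB
  obtain ⟨Δ, hΔ, hgap, -⟩ := h G hG r M θ sch n hM hθ hshape hβ htune
  exact ⟨Δ, hΔ, hgap⟩

/-! ## §3 The route from the minimal (B) -/

/-- **`U_gap → I → (B_Min) → (S_PVG) → YangMills`.** As `yangMills_of_trisectionGap`, reading from conjunct (B) only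
`Δ > 0` and `HasLatticeMassGap r sch Δ`: (S_PVG) gives the tuned scheme with polynomial volume growth, (B_Min) the lattice
gap, child I the infrared data of the sequence, child U in gap currency the witness `sch'` (same `a, β, L`), `T` and its
continuum gap `Δ₁`; the sub-problem's gap is `min Δ Δ₁`. -/
theorem yangMills_of_trisectionGapMin :
    UltravioletLimitWithGapOnTrajectory → ClusteringOnTrajectory → LatticeGapOnTrajectoryMin →
      TunedSequenceExistsPVG → YangMills := by
  intro hU hI hB hS G _ _ _ _ hG
  obtain ⟨r⟩ := hG.2
  letI : MeasurableSpace G := borel G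
  haveI : BorelSpace G := ⟨rfl⟩
  obtain ⟨M₀, hM₀⟩ := hU G hG r
  have hM2 : 2 ≤ max M₀ 2 := le_max_right _ _
  obtain ⟨θ₀, hθ₀, hU'⟩ := hM₀ (max M₀ 2) (le_max_left _ _) hM2
  obtain ⟨θ₁, hθ₁, hS'⟩ := hS G hG r (max M₀ 2) hM2
  have hθpos : 0 < min θ₀ θ₁ / 2 := by positivity
  have hθlt₀ : min θ₀ θ₁ / 2 < θ₀ := by have := min_le_left θ₀ θ₁; linarith
  have hθlt₁ : min θ₀ θ₁ / 2 < θ₁ := by have := min_le_right θ₀ θ₁; linarith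
  obtain ⟨sch, n, hshape, hbeta, hconv, htune, hgrowth⟩ := hS' (min θ₀ θ₁ / 2) hθpos hθlt₁
  obtain ⟨Δ, hΔ, hgap⟩ := hB G hG r (max M₀ 2) (min θ₀ θ₁ / 2) sch n hM2 hθpos hshape hbeta htune
  have hIR := hI G hG r (max M₀ 2) (min θ₀ θ₁ / 2) Δ sch n hθpos hΔ hshape hbeta hconv htune hgap hgrowth
  obtain ⟨sch', ha, hβ, hL, T, hYM, hNT, hNG, Δ₁, hΔ₁, hTgap⟩ :=
    hU' (min θ₀ θ₁ / 2) Δ sch n hθpos hθlt₀ hΔ hshape hbeta hconv htune hgap hgrowth hIR.1 hIR.2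
  have hweak : sch'.HasWeakCouplingLimit := by
    show Tendsto sch'.β atTop atTop
    rw [hβ]
    exact hbeta
  have hgap' : HasLatticeMassGap r sch (min Δ Δ₁) := Split.hasLatticeMassGap_of_le r sch (min_le_left _ _) hgap
  refine ⟨r, sch', T, hweak, hYM, hNT, hNG, min Δ Δ₁, lt_min hΔ hΔ₁,
    osData_hasMassGap_anti' T (min_le_right _ _) hTgap, ?_⟩
  intro A B
  obtain ⟨C, hC⟩ := hgap' A B
  refine ⟨C, ?_⟩
  simpa only [ha, hβ, hL] using hC

/-- **The whole route from the chart, the UV engine, child I, the MINIMAL (B) and the repaired (S).** -/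
theorem yangMills_of_trisectionGapMin_inputs :
    ChartExists → UVPhysics345 → ClusteringOnTrajectory → LatticeGapOnTrajectoryMin →
      TunedSequenceExistsPVG → YangMills :=
  fun hchart huv => yangMills_of_trisectionGapMin (ultravioletLimitWithGapOnTrajectory_of_inputs hchart huv)

-- (The Sub₁ form `yangMills_of_trisectionGap` of `…TrisectionGap` factors through the minimum:
--  `fun hU hI hB => yangMills_of_trisectionGapMin hU hI (latticeGapOnTrajectoryMin_of_lat hB)` has its type; not re-declared.)

end Summit.QuantumFields.YangMills.Cruxes.LatticeGapOnTrajectory.TrisectionGap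

end
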